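import Literature.IUT.HodgeArakelov.MonoThetaFromGroupsProofsTate
import Literature.AnabelianGeometry.SemiGraphs.BTempResEquiv
import Literature.AlgebraicGeometry.Frobenioids.CoproductCompletionConnected
import Literature.AnabelianGeometry.EtaleTheta.FrobenioidMonoThetaEnv
import Mathlib.CategoryTheory.ObjectProperty.Equivalence
import HarnessLib

/-!
# [IUTchII] §1, Proposition 1.2 (ii): the base category `B^temp(Π)⁰` made concrete and the interface
# instance for a genuine tempered Frobenioid (bridge B8 part 7)

S. Mochizuki, *Inter-universal Teichmüller theory II*, §1, Proposition 1.2 (ii), kurims manuscript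
(Dec. 2020) p. 25 l. 48 – p. 26 l. 9 (read on the page, `paper:url-5036b4059555` p. 25–26)
[claim: Mochizuki2012, status: disputed] (IUTchII §1 Prop 1.2 (ii), kurims pp.25-26): "Let `𝒞` be a
category equivalent to the tempered Frobenioid determined by `X̲̲_k` […]. Thus, `𝒞` admits a natural
Frobenioid structure over a base category `𝒟` equivalent to `B^temp(Π^tp_{X̲̲_k})⁰` [cf. [FrdI],
Corollary 4.11, (ii), (iv); [EtTh], Proposition 5.1]. Then there exists a functorial algorithm
`𝒞 ↦ M^Θ(𝒞)` for constructing from the category `𝒞` a mod `N` mono-theta environment [cf. [EtTh],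
Theorem 5.10, (iii)] such that the composite of this algorithm with the algorithm
`M^Θ(𝒞) ↦ Π_X(M^Θ(𝒞))` discussed in Definition 1.1, (i), admits a functorial isomorphism
`𝒟 ⥲ B^temp(Π_X(M^Θ(𝒞)))⁰`." Printed proof (p. 26): "The assertions of Proposition 1.2 follow
immediately from the results of [EtTh] that are quoted in the statements of these assertions."

abc-iut cell, DAG node `IUTchII:Prop1.2(ii)` (cone of [IUTchIII] Cor. 3.12), SUB-DAG
`plan/L6/SUBDAG-IUTchII-Prop-12ii.md` row r7 (seat abc-iut-w5-d177; the successor item "B8 part 7"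
named by the discharge seat abc-iut-w4-d008). The typer's interface (abc-iut-L6-t1,
`MonoThetaFromGroups.lean` p406189) `TemperedFrobenioidData S` carries the assignment
`Π ↦ B^temp(Π)⁰` as an ABSTRACT field `Btemp0 : TopGroup → Type (u+1)` with an abstract transport
`Btemp0_map` along isomorphisms of topological groups. This file makes both CONCRETE from the tree:

* `BTemp0 G := (B^temp(G))⁰` — the connected part ([FrdI] §0 p. 16, abc-iut-found's
  `Literature.AlgebraicGeometry.Frobenioids.ConnectedPart`) of abc-iut-L3's `B^temp(G)`
  (`Literature.AnabelianGeometry.SemiGraphs.BTemp`, [SemiAnbd] §3 p. 33);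
* `BTemp0.equivOfIso e : BTemp0 G ≌ BTemp0 H` for `e : G ≃ₜ* H` — [SemiAnbd] Rmk. 3.1.2 functoriality
  (abc-iut-L3's `BTemp.resEquiv`) restricted to connected objects (Mathlib
  `Equivalence.congrFullSubcategory`; connectedness = "nonempty single orbit",
  `QuasiTemperoid.BTempConnected.isConnectedObj_iff`, is preserved and reflected by pull-back along an
  isomorphism: `BTemp0.isConnectedObj_res_iff`);
* `TemperedFrobenioidData.ofBaseEquiv S base e` — the interface INSTANCE for any Frobenioid structure
  functor `base : 𝒞 ⥤ 𝒟` with `e : 𝒟 ≌ B^temp(Π^tp_{X̲̲_k})⁰`, in particular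
  (`TemperedFrobenioidData.ofThetaFrobenioid`) for abc-iut-L2-t4's [EtTh] §5 data
  `ThetaFrobenioid 𝒞 𝒟` (base functor `𝔉.pre.base`);
* `exists_envOfFrobenioid_frdMonoThetaEnv` — **Prop. 1.2 (ii) END TO END for that instance with
  `M^Θ(𝒞) :=` THE Frobenioid-theoretic mono-theta environment `E^Π_N` of [EtTh] Lemma 5.9 (iv) /
  Theorem 5.10 (iii)** (abc-iut-L2-t4's `ThetaFrobenioid.frdMonoThetaEnv`), with the Prop. 1.2 (i)
  isomorphism-indeterminacy clause for its Def. 1.1 (i) output: an application of abc-iut-w4-d008's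
  `exists_envOfFrobenioid_of_isMonoThetaEnv` (p412730). Hypotheses, all BY NAME (no `def … : Prop` is
  introduced here, D-0067 (1)): the frame `ModelFrame S R` / `ModelAgreement` of bridge B8 (abc-iut-L6-d6),
  the named [EtTh] facts `ThetaEnvData.Cor218_ii` (Cor. 2.18 (ii)) and `RigidData.Cor218_iv_fibre`
  (Cor. 2.18 (iv)), and [EtTh] Lemma 5.9 (iv) "In particular, omitting the homomorphism `s^⊓-Π_N` yields a
  mod `N` mono-theta environment" in the form `R.toThetaEnvData.IsMonoThetaEnv (𝔉.frdMonoThetaEnv …)` —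
  literally abc-iut-L2-t4's `ThetaFrobenioid.FrdIsMonoThetaEnv … R.toThetaEnvData` (FrobenioidMonoThetaEnv
  p410580; discharged modulo L2's named inputs in `Discharge/Sec5BiThetaIso` p410924), unfolded only so that
  the level `𝔉.N` need not be definitionally `S.N`.

Residual (recorded, not hidden): for §5 data over an ABSTRACT base `𝒟` the equivalence
`e : 𝒟 ≌ B^temp(Π^tp_{X̲̲_k})⁰` stays a binder (data, not a published fact; for the MODEL base of
abc-iut-L2-t3's tempered Frobenioid it is not in the tree — abc-iut-L2-t9, `ThetaFrobenioidOfTempered`: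
"needs `D = B^temp(Π^tp_X)⁰` concretely"); for §5 data over the LITERAL base `B^temp(Π^tp_{X̲̲_k})⁰` (the shape
of abc-iut-L2-t9's `ThetaSubquotientOfTempered`) it is the identity and disappears
(`TemperedFrobenioidData.ofBTemp0`, `exists_envOfFrobenioid_frdMonoThetaEnv_bTemp0`).
HONEST FRAMING: constructions and kernel-checked implications between typed statements; nothing here
asserts a disputed claim or takes a side on [IUTchIII] Cor. 3.12; typed ≠ proved elsewhere.
-/

noncomputable section

namespace Literature.IUT.HodgeArakelov

universe w u

open CategoryTheory Literature.AnabelianGeometry.SemiGraphs Literature.AlgebraicGeometry.Frobenioids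
  Literature.AnabelianGeometry.EtaleTheta

/-! ## `B^temp(Π)⁰` -/

/-- **`B^temp(Π)⁰`**, the connected part ([FrdI] §0 p. 16: "`𝒞⁰ ⊆ 𝒞`, the full subcategory of connected
objects") of the category `B^temp(Π)` of countable discrete continuous `Π`-sets ([SemiAnbd] §3 p. 33) — the
"connected temperoid" `B^temp(Π^tp_{X̲̲_k})⁰` of [IUTchII] Prop. 1.2 (ii) (kurims p. 25: "a base category
`𝒟` equivalent to `B^temp(Π^tp_{X̲̲_k})⁰`"), for a bundled topological group.
[claim: Mochizuki2012, status: disputed] (IUTchII §1 Prop 1.2 (ii), kurims p.25) -/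
abbrev BTemp0 (G : TopGroup.{u}) : Type (u + 1) := ConnectedPart (BTemp G)

namespace BTemp0

variable {G H : TopGroup.{u}}

/-- Connectedness in `B^temp(Π)` is invariant under isomorphism ([FrdI] §0 p. 15): the object property
cutting out `B^temp(Π)⁰` is closed under isomorphisms (Mathlib `IsClosedUnderIsomorphisms`, stated as a
theorem and supplied explicitly where used — no instance is declared).
[cite: MochizukiFrdI2008, §0 p.15] -/
theorem isClosedUnderIsomorphisms_connectedObjects (G : TopGroup.{u}) :
    (connectedObjects (BTemp G)).IsClosedUnderIsomorphisms :=
  ⟨fun e h => IsConnectedObj.of_iso h e⟩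

/-- Pull-back along an ISOMORPHISM of topological groups `e : H ≃ Π` preserves and reflects connected
objects of `B^temp(−)`: both sides are "nonempty and a single orbit"
(`QuasiTemperoid.BTempConnected.isConnectedObj_iff`), and the orbits of `Π` and of `H` acting through `e`
coincide. [cite: MochizukiSemiAnbd2006, Rmk 3.1.2 pp.33-34] -/
theorem isConnectedObj_res_iff (e : H ≃ₜ* G) (X : BTemp G) :
    IsConnectedObj ((BTemp.res (e : H →ₜ* G)).obj X) ↔ IsConnectedObj X := by
  rw [QuasiTemperoid.BTempConnected.isConnectedObj_iff, QuasiTemperoid.BTempConnected.isConnectedObj_iff]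
  refine and_congr Iff.rfl ⟨fun h x₀ x => ?_, fun h x₀ x => ?_⟩
  · obtain ⟨g, hg⟩ := h x₀ x
    exact ⟨e g, hg⟩
  · obtain ⟨g, hg⟩ := h x₀ x
    refine ⟨e.symm g, ?_⟩
    change X.obj.ρ (e (e.symm g)) x₀ = x
    rwa [e.apply_symm_apply]

/-- The object property "connected" of `B^temp(H)` pulls back, along the equivalence `B^temp(Π) ≌ B^temp(H)`
induced by `e : Π ≃ H` (abc-iut-L3's `BTemp.resEquiv e⁻¹`), to the object property "connected" of
`B^temp(Π)`. [cite: MochizukiSemiAnbd2006, Rmk 3.1.2 pp.33-34] -/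
theorem inverseImage_connectedObjects (e : G ≃ₜ* H) :
    (connectedObjects (BTemp H)).inverseImage (BTemp.resEquiv e.symm).functor =
      connectedObjects (BTemp G) := by
  ext X
  exact isConnectedObj_res_iff e.symm X

/-- **`B^temp(−)⁰` along an isomorphism of topological groups**: `e : Π ≃ H` induces
`B^temp(Π)⁰ ≌ B^temp(H)⁰` ([SemiAnbd] Rmk. 3.1.2: "any continuous homomorphism `Π → Π'` determines … a
morphism of connected temperoids"), the restriction of `BTemp.resEquiv e⁻¹` to connected objects. This is
the transport `Btemp0_map` the [IUTchII] Prop. 1.2 (ii) interface asks for.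
[cite: MochizukiSemiAnbd2006, Rmk 3.1.2 pp.33-34] -/
def equivOfIso (e : G ≃ₜ* H) : BTemp0 G ≌ BTemp0 H :=
  haveI := isClosedUnderIsomorphisms_connectedObjects H
  (BTemp.resEquiv e.symm).congrFullSubcategory (inverseImage_connectedObjects e)

/-- On objects `equivOfIso e` is pull-back along `e⁻¹`: the underlying `H`-set of the image of `X` is the
set of `X` with `h` acting as `e⁻¹ h`. [cite: MochizukiSemiAnbd2006, Rmk 3.1.2 pp.33-34] -/
theorem equivOfIso_functor_obj (e : G ≃ₜ* H) (X : BTemp0 G) :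
    ((equivOfIso e).functor.obj X).obj = (BTemp.res (e.symm : H →ₜ* G)).obj X.obj :=
  rfl

end BTemp0

/-! ## The Prop. 1.2 (ii) interface instantiated -/

namespace TemperedFrobenioidData

/-- **The [IUTchII] Prop. 1.2 (ii) interface INSTANTIATED** for a Frobenioid structure functor
`base : 𝒞 ⥤ 𝒟` ("`𝒞` admits a natural Frobenioid structure over a base category `𝒟`", kurims p. 25) and an
equivalence `e : 𝒟 ≌ B^temp(Π^tp_{X̲̲_k})⁰` ("`𝒟` equivalent to `B^temp(Π^tp_{X̲̲_k})⁰`"), with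
`Π ↦ B^temp(Π)⁰` the CONCRETE `BTemp0` and its transport `BTemp0.equivOfIso`.
[claim: Mochizuki2012, status: disputed] (IUTchII §1 Prop 1.2 (ii), kurims p.25) -/
def ofBaseEquiv (S : ThetaSetting.{u}) {C : Type (u + 1)} [Category.{u} C] {D : Type (u + 1)}
    [Category.{u} D] (base : C ⥤ D) (e : D ≌ BTemp0 S.PiX) : TemperedFrobenioidData S where
  C := C
  D := D
  base := base
  Btemp0 := BTemp0
  Btemp0_map f := BTemp0.equivOfIso f
  baseEquiv := e

/-- **The interface instance for an [EtTh] §5 tempered Frobenioid** `𝔉 : ThetaFrobenioid 𝒞 𝒟`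
(abc-iut-L2-t4, `FrobenioidTheta.lean`; "the Frobenioid denoted `𝒞` in the discussion at the beginning of
[EtTh], §5", kurims p. 25), base functor `𝒞 → 𝒟` of its pre-Frobenioid data, given
`e : 𝒟 ≌ B^temp(Π^tp_{X̲̲_k})⁰`. [claim: Mochizuki2012, status: disputed] (IUTchII §1 Prop 1.2 (ii), kurims p.25) -/
def ofThetaFrobenioid (S : ThetaSetting.{u}) {C : Type (u + 1)} [Category.{u} C] {D : Type (u + 1)}
    [Category.{u} D] (𝔉 : ThetaFrobenioid.{w} C D) (e : D ≌ BTemp0 S.PiX) : TemperedFrobenioidData S :=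
  ofBaseEquiv S 𝔉.pre.base e

/-- The instance has `𝒞 := 𝒞`. [claim: Mochizuki2012, status: disputed] (IUTchII §1 Prop 1.2 (ii), kurims p.25) -/
theorem ofThetaFrobenioid_C (S : ThetaSetting.{u}) {C : Type (u + 1)} [Category.{u} C] {D : Type (u + 1)}
    [Category.{u} D] (𝔉 : ThetaFrobenioid.{w} C D) (e : D ≌ BTemp0 S.PiX) :
    (ofThetaFrobenioid S 𝔉 e).C = C :=
  rfl

/-- The instance has base functor `𝔉.pre.base : 𝒞 ⥤ 𝒟`. [claim: Mochizuki2012, status: disputed] (IUTchII §1 Prop 1.2 (ii), kurims p.25) -/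
theorem ofThetaFrobenioid_base (S : ThetaSetting.{u}) {C : Type (u + 1)} [Category.{u} C]
    {D : Type (u + 1)} [Category.{u} D] (𝔉 : ThetaFrobenioid.{w} C D) (e : D ≌ BTemp0 S.PiX) :
    (ofThetaFrobenioid S 𝔉 e).base = 𝔉.pre.base :=
  rfl

/-- The instance has `baseEquiv := e`. [claim: Mochizuki2012, status: disputed] (IUTchII §1 Prop 1.2 (ii), kurims p.25) -/
theorem ofThetaFrobenioid_baseEquiv (S : ThetaSetting.{u}) {C : Type (u + 1)} [Category.{u} C]
    {D : Type (u + 1)} [Category.{u} D] (𝔉 : ThetaFrobenioid.{w} C D) (e : D ≌ BTemp0 S.PiX) :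
    (ofThetaFrobenioid S 𝔉 e).baseEquiv = e :=
  rfl

/-- **The binder-free case**: for §5 data whose base category IS `B^temp(Π^tp_{X̲̲_k})⁰` literally — the shape
of abc-iut-L2-t9's adapters (`ThetaSubquotientOfTempered`: "the REAL instance, for the base category
`D = B^temp(Π)⁰`") — the equivalence `𝒟 ≌ B^temp(Π^tp_{X̲̲_k})⁰` is the identity and no binder remains.
[claim: Mochizuki2012, status: disputed] (IUTchII §1 Prop 1.2 (ii), kurims p.25) -/
def ofBTemp0 (S : ThetaSetting.{u}) {C : Type (u + 1)} [Category.{u} C]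
    (𝔉 : ThetaFrobenioid.{w} C (BTemp0 S.PiX)) : TemperedFrobenioidData S :=
  ofThetaFrobenioid S 𝔉 CategoryTheory.Equivalence.refl

/-- In the binder-free case `baseEquiv` is the identity equivalence. [claim: Mochizuki2012, status: disputed] (IUTchII §1 Prop 1.2 (ii), kurims p.25) -/
theorem ofBTemp0_baseEquiv (S : ThetaSetting.{u}) {C : Type (u + 1)} [Category.{u} C]
    (𝔉 : ThetaFrobenioid.{w} C (BTemp0 S.PiX)) :
    (ofBTemp0 S 𝔉).baseEquiv = CategoryTheory.Equivalence.refl :=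
  rfl

end TemperedFrobenioidData

/-! ## Prop. 1.2 (ii) end to end for the genuine `M^Θ(𝒞)` -/

section EndToEnd

variable {S : ThetaSetting.{u}} {l : ℕ} {R : RigidData.{u} S.N l}

/-- **[IUTchII] Prop. 1.2 (ii), END TO END for an [EtTh] §5 tempered Frobenioid with `M^Θ(𝒞) :=` the
Frobenioid-theoretic mono-theta environment of [EtTh] Lemma 5.9 (iv) / Theorem 5.10 (iii).** For
`𝔉 : ThetaFrobenioid 𝒞 𝒟` with `e : 𝒟 ≌ B^temp(Π^tp_{X̲̲_k})⁰`, over a frame `ModelFrame S R` /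
`ModelAgreement` (bridge B8) and modulo the named [EtTh] facts Cor. 2.18 (ii) (`ThetaEnvData.Cor218_ii`),
Cor. 2.18 (iv) (`RigidData.Cor218_iv_fibre`) and Lemma 5.9 (iv) "In particular … a mod `N` mono-theta
environment" (`hM` = abc-iut-L2-t4's `ThetaFrobenioid.FrdIsMonoThetaEnv … R.toThetaEnvData`, unfolded):
there is an output `E : EnvOfFrobenioid (ofThetaFrobenioid S 𝔉 e)` of Prop. 1.2 (ii) whose `M^Θ(𝒞)` has
underlying [EtTh] datum EXACTLY `E^Π_N = 𝔉.frdMonoThetaEnv …` and whose Def. 1.1 (i) output has the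
Prop. 1.2 (i) isomorphism indeterminacy ("a group of `μ_N`-conjugacy classes of automorphisms which is of
order `1` (respectively, `2`) if `N` is odd (respectively, even)"). One application of abc-iut-w4-d008's
`exists_envOfFrobenioid_of_isMonoThetaEnv`. [claim: Mochizuki2012, status: disputed] (IUTchII §1 Prop 1.2 (ii), kurims pp.25-26) -/
theorem exists_envOfFrobenioid_frdMonoThetaEnv (F : ModelFrame S R)
    (A : ModelAgreement S R.toThetaEnvData) (h218ii : R.toThetaEnvData.Cor218_ii)
    (hfib : R.Cor218_iv_fibre) {C : Type (u + 1)} [Category.{u} C] {D : Type (u + 1)} [Category.{u} D]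
    (𝔉 : ThetaFrobenioid.{w} C D) (h1 : 𝔉.SectionsFactor) (h3 : 𝔉.OuterActionLZ)
    (hsec : 𝔉.SgpCapSection) (hcs : 𝔉.SgpCupSection) (h8 : 𝔉.ConstantsEqNormalizer)
    (DK : Set (TopOut 𝔉.EPiN))
    (hM : R.toThetaEnvData.IsMonoThetaEnv (𝔉.frdMonoThetaEnv h1 h3 hsec hcs h8 DK))
    (e : D ≌ BTemp0 S.PiX) :
    ∃ E : EnvOfFrobenioid (TemperedFrobenioidData.ofThetaFrobenioid S 𝔉 e),
      E.env.toEtale = 𝔉.frdMonoThetaEnv h1 h3 hsec hcs h8 DK ∧ Prop12_i_indeterminacy E.recon :=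
  exists_envOfFrobenioid_of_isMonoThetaEnv F A h218ii hfib _ hM _

/-- The same with [EtTh] Cor. 2.18 (iv) supplied by L2's PROVED implication from Prop. 2.14 (i)
(`RigidData.cor218_iv_fibre_of_prop214_i`, abc-iut-L2-t10). [claim: Mochizuki2012, status: disputed] (IUTchII §1 Prop 1.2 (ii), kurims pp.25-26) -/
theorem exists_envOfFrobenioid_frdMonoThetaEnv_of_prop214_i (F : ModelFrame S R)
    (A : ModelAgreement S R.toThetaEnvData) (h218ii : R.toThetaEnvData.Cor218_ii)
    (h214 : R.Prop214_i) {C : Type (u + 1)} [Category.{u} C] {D : Type (u + 1)} [Category.{u} D]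
    (𝔉 : ThetaFrobenioid.{w} C D) (h1 : 𝔉.SectionsFactor) (h3 : 𝔉.OuterActionLZ)
    (hsec : 𝔉.SgpCapSection) (hcs : 𝔉.SgpCupSection) (h8 : 𝔉.ConstantsEqNormalizer)
    (DK : Set (TopOut 𝔉.EPiN))
    (hM : R.toThetaEnvData.IsMonoThetaEnv (𝔉.frdMonoThetaEnv h1 h3 hsec hcs h8 DK))
    (e : D ≌ BTemp0 S.PiX) :
    ∃ E : EnvOfFrobenioid (TemperedFrobenioidData.ofThetaFrobenioid S 𝔉 e),
      E.env.toEtale = 𝔉.frdMonoThetaEnv h1 h3 hsec hcs h8 DK ∧ Prop12_i_indeterminacy E.recon :=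
  exists_envOfFrobenioid_frdMonoThetaEnv F A h218ii (R.cor218_iv_fibre_of_prop214_i h214) 𝔉 h1 h3 hsec
    hcs h8 DK hM e

/-- **The binder-free end-to-end form**: §5 data over the literal base `B^temp(Π^tp_{X̲̲_k})⁰`; the output's
`M^Θ(𝒞)` is `E^Π_N`, its base equivalence starts from the identity of `B^temp(Π^tp_{X̲̲_k})⁰`.
[claim: Mochizuki2012, status: disputed] (IUTchII §1 Prop 1.2 (ii), kurims pp.25-26) -/
theorem exists_envOfFrobenioid_frdMonoThetaEnv_bTemp0 (F : ModelFrame S R)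
    (A : ModelAgreement S R.toThetaEnvData) (h218ii : R.toThetaEnvData.Cor218_ii)
    (hfib : R.Cor218_iv_fibre) {C : Type (u + 1)} [Category.{u} C]
    (𝔉 : ThetaFrobenioid.{w} C (BTemp0 S.PiX)) (h1 : 𝔉.SectionsFactor) (h3 : 𝔉.OuterActionLZ)
    (hsec : 𝔉.SgpCapSection) (hcs : 𝔉.SgpCupSection) (h8 : 𝔉.ConstantsEqNormalizer)
    (DK : Set (TopOut 𝔉.EPiN))
    (hM : R.toThetaEnvData.IsMonoThetaEnv (𝔉.frdMonoThetaEnv h1 h3 hsec hcs h8 DK)) :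
    ∃ E : EnvOfFrobenioid (TemperedFrobenioidData.ofBTemp0 S 𝔉),
      E.env.toEtale = 𝔉.frdMonoThetaEnv h1 h3 hsec hcs h8 DK ∧ Prop12_i_indeterminacy E.recon :=
  exists_envOfFrobenioid_frdMonoThetaEnv F A h218ii hfib 𝔉 h1 h3 hsec hcs h8 DK hM _

end EndToEnd

end Literature.IUT.HodgeArakelov

end
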